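import Summits.Ventures.Crystal3D.Theorems.StickyWulffConstantTextureLiminfLineCountGlueMix
import Summits.Ventures.Crystal3D.Theorems.StickyWulffConstantTextureLiminfLayerCountStrip
import Summits.Ventures.Crystal3D.Theorems.StickyWulffConstantTextureLiminfTexShadowRowStripDefs
import HarnessLib

/-!
# The wall cell's charge against zigzag lines and PER-STRIP c-layer rows (v3 of the row corner, DECISION (xxxvii⁗))
# (LAYER-FLUX chain; crux `TextureLiminf`, stmt-Ventures-19483)

HONEST FRAMING. Venture `Summits/Ventures/Crystal3D` (cell `crystal3d-full`), helper `--supports` the crux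
`TextureLiminf` (stmt-Ventures-19483) of `route-Ventures-StickyWulffConstant`, registered line `TexShadow`.  Rung credit
only; F-C1 not moved.  NOT the wall law: a counting inequality (charge ≤ weighted line counts), whatever lane G can pay for.

The per-strip twin of `cell_charge_le_lines_mix` (p654682): the row family's flux is `rowFlux τ L σ z i = [IsCLayer σ i]·layerFlux`
(`…TexShadowRowStripDefs`), counted against the `++` c-layer rows only (`layer_lines_ge_flux_strip`, `…LayerCountStrip`).

* `RowStripDominated τ a₁ b₁ a₂ b₂ L₁ σ₁ L₂ σ₂ c` — `c i j ≤ ½((a₁·plateFlux₁ i + b₁·rowFlux₁ i) + (a₂·plateFlux₂ j + b₂·rowFlux₂ j))`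
  (at the corner weights `(zigW, rowW)` of each plate this is `RowMixDominated`, `rowStripDominated_of_rowMixDominated`);
* `tsum_flux_add` — splitting a sum of two bounded per-strip fluxes;
* **`cell_charge_le_lines_rowstrip`** — weights in `[0,1]`, dominated `c ≥ 0`, `1/4 ≤ τ₀` ⇒
  `2·Q_ρ(c) ≤ a₁#T₁ + a₂#T₂ + b₁#T₃ + b₂#T₄ + 160(R₀+9)(1+h)ρ`, where `T₃ / T₄ ⊇` the `++` c-layer rows of the bottom / top plate with a
  site in the window (zigzag windows `T₁ / T₂` as before).
WHAT THIS IS NOT: not the row walker family (lane G); F-C1 not moved.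
-/

noncomputable section

namespace Summit.Ventures.Crystal3D.Cruxes.TextureLiminf.TexShadow

/-- **the charge table `c` is ROW-STRIP-DOMINATED at steepness `τ` with per-plate weights** `(a₁, b₁)` (bottom plate: zigzag,
c-layer rows) and `(a₂, b₂)` (top plate): strip by strip `c i j ≤ ½ ((a₁·plateFlux₁ i + b₁·rowFlux₁ i) + (a₂·plateFlux₂ j + b₂·rowFlux₂ j))`. -/
def RowStripDominated (τ a₁ b₁ a₂ b₂ : ℝ) (L₁ : E3 ≃ₗᵢ[ℝ] E3) (σ₁ : ℤ → ℤ) (L₂ : E3 ≃ₗᵢ[ℝ] E3) (σ₂ : ℤ → ℤ)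
    (c : ℤ → ℤ → ℝ) : Prop :=
  ∀ i j : ℤ, c i j ≤ (a₁ * plateFlux τ L₁ σ₁ e₃ i + b₁ * rowFlux τ L₁ σ₁ e₃ i +
    (a₂ * plateFlux τ L₂ σ₂ (-e₃) j + b₂ * rowFlux τ L₂ σ₂ (-e₃) j)) / 2

/-- At the corner weights, `RowMixDominated` is `RowStripDominated`. -/
theorem rowStripDominated_of_rowMixDominated {τ : ℝ} {L₁ L₂ : E3 ≃ₗᵢ[ℝ] E3} {σ₁ σ₂ : ℤ → ℤ} {c : ℤ → ℤ → ℝ}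
    (h : RowMixDominated τ L₁ σ₁ L₂ σ₂ c) :
    RowStripDominated τ (zigW L₁ σ₁ e₃) (rowW L₁ σ₁ e₃) (zigW L₂ σ₂ (-e₃)) (rowW L₂ σ₂ (-e₃)) L₁ σ₁ L₂ σ₂ c := by
  intro i j
  have := h i j
  rw [cornerFlux_eq_weights, cornerFlux_eq_weights] at this
  exact this

end Summit.Ventures.Crystal3D.Cruxes.TextureLiminf.TexShadow

namespace Summit.Ventures.Crystal3D.Theorems

open MeasureTheory Set
open scoped ENNReal InnerProductSpace
open Literature.MathematicalPhysics.StatisticalMechanics (IsHaggSeq triangularVec₁ triangularVec₂)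
open Summit.Ventures.Crystal3D.Cruxes.TextureLiminf.TexShadow (E3 e₃ cyl stacking laySlab bilayerRise PlateLaunchable plateFlux
  layerFlux layerFlux_nonneg layerFlux_le_sqrt_two FluxDominated MixFluxDominated BilayerWallAt IsCLayer rowFlux zigW rowW
  RowMixDominated RowStripDominated rowFlux_nonneg_le cornerFlux_eq_weights)

/-! ## The weighted cell bound -/

/-- Splitting a sum of two bounded per-strip fluxes: `Σ'ᵢ (fᵢ + gᵢ)|X ∩ slabᵢ| = Σ'ᵢ fᵢ|X ∩ slabᵢ| + Σ'ᵢ gᵢ|X ∩ slabᵢ|`. -/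
theorem tsum_flux_add (L : E3 ≃ₗᵢ[ℝ] E3) (s : E3) (f g : ℤ → ℝ) (A : ℝ) (hf0 : ∀ i, 0 ≤ f i) (hfA : ∀ i, f i ≤ A)
    (hg0 : ∀ i, 0 ≤ g i) (hgA : ∀ i, g i ≤ A) (X : Set E3) (hX : MeasurableSet X) (hXfin : volume X ≠ ⊤) :
    ∑' i : ℤ, (f i + g i) * (volume (X ∩ laySlab L s i)).toReal =
      ∑' i : ℤ, f i * (volume (X ∩ laySlab L s i)).toReal + ∑' i : ℤ, g i * (volume (X ∩ laySlab L s i)).toReal := by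
  have hsum := measure_eq_tsum_inter_laySlab L s X hX
  have hv : Summable fun i : ℤ => (volume (X ∩ laySlab L s i)).toReal := ENNReal.summable_toReal (by rw [← hsum]; exact hXfin)
  have hfv : Summable fun i : ℤ => f i * (volume (X ∩ laySlab L s i)).toReal :=
    Summable.of_nonneg_of_le (fun i => mul_nonneg (hf0 i) ENNReal.toReal_nonneg)
      (fun i => mul_le_mul_of_nonneg_right (hfA i) ENNReal.toReal_nonneg) (hv.mul_left A)
  have hgv : Summable fun i : ℤ => g i * (volume (X ∩ laySlab L s i)).toReal :=
    Summable.of_nonneg_of_le (fun i => mul_nonneg (hg0 i) ENNReal.toReal_nonneg)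
      (fun i => mul_le_mul_of_nonneg_right (hgA i) ENNReal.toReal_nonneg) (hv.mul_left A)
  rw [← hfv.tsum_add hgv]
  exact tsum_congr fun i => by ring

set_option maxHeartbeats 400000 in
/-- **The wall cell's charge against zigzag lines and per-strip c-layer rows.**  See the module docstring. -/
theorem cell_charge_le_lines_rowstrip {σ₁ σ₂ : ℤ → ℤ} (hσ₁ : IsHaggSeq σ₁) (hσ₂ : IsHaggSeq σ₂)
    (L₁ L₂ : E3 ≃ₗᵢ[ℝ] E3) (s₁ s₂ : E3) (τ₀ R₀ h ρ : ℝ) (hτ₀ : 1 / 4 ≤ τ₀) (hR₀ : 1 ≤ R₀) (hh : 0 ≤ h) (hρ : 0 ≤ ρ)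
    {a₁ b₁ a₂ b₂ : ℝ} (ha₁ : 0 ≤ a₁) (ha₁1 : a₁ ≤ 1) (hb₁ : 0 ≤ b₁) (hb₁1 : b₁ ≤ 1) (ha₂ : 0 ≤ a₂) (ha₂1 : a₂ ≤ 1)
    (hb₂ : 0 ≤ b₂) (hb₂1 : b₂ ≤ 1)
    (c : ℤ → ℤ → ℝ) (hc0 : ∀ i j, 0 ≤ c i j) (hdom : RowStripDominated τ₀ a₁ b₁ a₂ b₂ L₁ σ₁ L₂ σ₂ c)
    {step₁ : ℤ → E3} (hsel₁ : IsZigSelector L₁ σ₁ e₃ step₁) {step₂ : ℤ → E3} (hsel₂ : IsZigSelector L₂ σ₂ (-e₃) step₂)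
    (T₁ T₂ : Finset (Fin 2 → ℤ)) (T₃ T₄ : Finset (ℤ × ℤ))
    (hT₁ : ∀ t : Fin 2 → ℤ, (∃ k : ℤ,
        -R₀ - 4 ≤ (L₁ (zigVertexS step₁ k + ((t 0 : ℝ) • triangularVec₁ 1 + (t 1 : ℝ) • triangularVec₂ 1)) + s₁) 2 ∧
        (L₁ (zigVertexS step₁ k + ((t 0 : ℝ) • triangularVec₁ 1 + (t 1 : ℝ) • triangularVec₂ 1)) + s₁) 2 ≤ -R₀ - 3 ∧
        Real.sqrt ((L₁ (zigVertexS step₁ k + ((t 0 : ℝ) • triangularVec₁ 1 + (t 1 : ℝ) • triangularVec₂ 1)) + s₁) 0 ^ 2 +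
          (L₁ (zigVertexS step₁ k + ((t 0 : ℝ) • triangularVec₁ 1 + (t 1 : ℝ) • triangularVec₂ 1)) + s₁) 1 ^ 2) ≤ ρ) →
        t ∈ T₁)
    (hT₂ : ∀ t : Fin 2 → ℤ, (∃ k : ℤ,
        h + R₀ + 3 ≤ (L₂ (zigVertexS step₂ k + ((t 0 : ℝ) • triangularVec₁ 1 + (t 1 : ℝ) • triangularVec₂ 1)) + s₂) 2 ∧
        (L₂ (zigVertexS step₂ k + ((t 0 : ℝ) • triangularVec₁ 1 + (t 1 : ℝ) • triangularVec₂ 1)) + s₂) 2 ≤ h + R₀ + 4 ∧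
        Real.sqrt ((L₂ (zigVertexS step₂ k + ((t 0 : ℝ) • triangularVec₁ 1 + (t 1 : ℝ) • triangularVec₂ 1)) + s₂) 0 ^ 2 +
          (L₂ (zigVertexS step₂ k + ((t 0 : ℝ) • triangularVec₁ 1 + (t 1 : ℝ) • triangularVec₂ 1)) + s₂) 1 ^ 2) ≤ ρ) →
        t ∈ T₂)
    (hT₃ : ∀ kj : ℤ × ℤ, IsCLayer σ₁ kj.1 → (∃ i : ℤ,
        -R₀ - 4 ≤ (L₁ (layerSite σ₁ L₁ e₃ kj.1 i kj.2) + s₁) 2 ∧ (L₁ (layerSite σ₁ L₁ e₃ kj.1 i kj.2) + s₁) 2 ≤ -R₀ - 3 ∧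
        Real.sqrt ((L₁ (layerSite σ₁ L₁ e₃ kj.1 i kj.2) + s₁) 0 ^ 2 + (L₁ (layerSite σ₁ L₁ e₃ kj.1 i kj.2) + s₁) 1 ^ 2) ≤ ρ) →
        kj ∈ T₃)
    (hT₄ : ∀ kj : ℤ × ℤ, IsCLayer σ₂ kj.1 → (∃ i : ℤ,
        h + R₀ + 3 ≤ (L₂ (layerSite σ₂ L₂ (-e₃) kj.1 i kj.2) + s₂) 2 ∧
        (L₂ (layerSite σ₂ L₂ (-e₃) kj.1 i kj.2) + s₂) 2 ≤ h + R₀ + 4 ∧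
        Real.sqrt ((L₂ (layerSite σ₂ L₂ (-e₃) kj.1 i kj.2) + s₂) 0 ^ 2 +
          (L₂ (layerSite σ₂ L₂ (-e₃) kj.1 i kj.2) + s₂) 1 ^ 2) ≤ ρ) →
        kj ∈ T₄) :
    2 * ∑' ij : ℤ × ℤ, c ij.1 ij.2 * (volume (wallSlice ρ ∩ laySlab L₁ s₁ ij.1 ∩ laySlab L₂ s₂ ij.2)).toReal ≤
      a₁ * (T₁.card : ℝ) + a₂ * T₂.card + b₁ * T₃.card + b₂ * T₄.card + 160 * (R₀ + 9) * (1 + h) * ρ := by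
  classical
  have he₃ : ‖(e₃ : E3)‖ = 1 := by rw [e₃, PiLp.norm_single, norm_one]
  have hne₃ : ‖(-e₃ : E3)‖ = 1 := by rw [norm_neg, he₃]
  have hi₃ : ∀ p : E3, ⟪p, e₃⟫_ℝ = p 2 := fun p => by
    rw [e₃, EuclideanSpace.inner_single_right]; simp
  have hs2 : 0 ≤ Real.sqrt 2 := Real.sqrt_nonneg 2
  -- the two mixed fluxes, bounded by `2√2`
  set κ₁ : ℤ → ℝ := fun i => a₁ * plateFlux τ₀ L₁ σ₁ e₃ i + b₁ * rowFlux τ₀ L₁ σ₁ e₃ i with hκ₁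
  set κ₂ : ℤ → ℝ := fun j => a₂ * plateFlux τ₀ L₂ σ₂ (-e₃) j + b₂ * rowFlux τ₀ L₂ σ₂ (-e₃) j with hκ₂
  have hrow₁ : ∀ i, 0 ≤ rowFlux τ₀ L₁ σ₁ e₃ i ∧ rowFlux τ₀ L₁ σ₁ e₃ i ≤ Real.sqrt 2 := fun i =>
    ⟨(rowFlux_nonneg_le τ₀ L₁ σ₁ e₃ i).1, (rowFlux_nonneg_le τ₀ L₁ σ₁ e₃ i).2.trans (layerFlux_le_sqrt_two τ₀ L₁ he₃)⟩
  have hrow₂ : ∀ j, 0 ≤ rowFlux τ₀ L₂ σ₂ (-e₃) j ∧ rowFlux τ₀ L₂ σ₂ (-e₃) j ≤ Real.sqrt 2 := fun j =>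
    ⟨(rowFlux_nonneg_le τ₀ L₂ σ₂ (-e₃) j).1, (rowFlux_nonneg_le τ₀ L₂ σ₂ (-e₃) j).2.trans (layerFlux_le_sqrt_two τ₀ L₂ hne₃)⟩
  have hw : ∀ {a x : ℝ}, 0 ≤ a → a ≤ 1 → 0 ≤ x → x ≤ Real.sqrt 2 → 0 ≤ a * x ∧ a * x ≤ Real.sqrt 2 := fun ha ha1 hx hxB =>
    ⟨mul_nonneg ha hx, (mul_le_mul_of_nonneg_right ha1 hx).trans (by rw [one_mul]; exact hxB)⟩
  have hκ₁0 : ∀ i, 0 ≤ κ₁ i := fun i =>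
    add_nonneg (mul_nonneg ha₁ (plateFlux_nonneg τ₀ L₁ σ₁ he₃ i)) (mul_nonneg hb₁ (hrow₁ i).1)
  have hκ₂0 : ∀ j, 0 ≤ κ₂ j := fun j =>
    add_nonneg (mul_nonneg ha₂ (plateFlux_nonneg τ₀ L₂ σ₂ hne₃ j)) (mul_nonneg hb₂ (hrow₂ j).1)
  have hκ₁B : ∀ i, κ₁ i ≤ 2 * Real.sqrt 2 := fun i => by
    have h1 := (hw ha₁ ha₁1 (plateFlux_nonneg τ₀ L₁ σ₁ he₃ i) (plateFlux_le_sqrt_two τ₀ L₁ σ₁ he₃ i)).2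
    have h2 := (hw hb₁ hb₁1 (hrow₁ i).1 (hrow₁ i).2).2
    simp only [hκ₁]; linarith
  have hκ₂B : ∀ j, κ₂ j ≤ 2 * Real.sqrt 2 := fun j => by
    have h1 := (hw ha₂ ha₂1 (plateFlux_nonneg τ₀ L₂ σ₂ hne₃ j) (plateFlux_le_sqrt_two τ₀ L₂ σ₂ hne₃ j)).2
    have h2 := (hw hb₂ hb₂1 (hrow₂ j).1 (hrow₂ j).2).2
    simp only [hκ₂]; linarith
  have hdomκ : ∀ i j, c i j ≤ (κ₁ i + κ₂ j) / 2 := fun i j => by simp only [hκ₁, hκ₂]; exact hdom i j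
  have hcB : ∀ i j, c i j ≤ 2 * Real.sqrt 2 := fun i j => (hdomκ i j).trans (by linarith [hκ₁B i, hκ₂B j])
  have h418 := four_sqrt_two_pi_le
  have hπ0 := Real.pi_pos.le
  set d : ℝ := 4 * h + 4 * R₀ + 36 with hd
  have hd0 : 0 ≤ d := by rw [hd]; positivity
  have hdle : d ≤ 4 * (R₀ + 9) * (1 + h) := by rw [hd]; nlinarith
  have hT0 : (0 : ℝ) ≤ a₁ * (T₁.card : ℝ) + a₂ * T₂.card + b₁ * T₃.card + b₂ * T₄.card := by positivity
  have hSfin : ∀ r, 0 ≤ r → volume (wallSlice r) ≠ ⊤ := fun r hr => by rw [volume_wallSlice r hr]; exact ENNReal.ofReal_ne_top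
  by_cases hsmall : ρ ≤ d
  · -- degenerate: the whole slice is rim
    have h1 := two_charge_le_const L₁ L₂ s₁ s₂ c (2 * Real.sqrt 2) hc0 hcB (wallSlice ρ) (measurableSet_wallSlice ρ) (hSfin ρ hρ)
    rw [volume_wallSlice ρ hρ, ENNReal.toReal_ofReal (by positivity)] at h1
    have h2 : Real.pi * ρ ^ 2 ≤ Real.pi * (ρ * d) := mul_le_mul_of_nonneg_left (by nlinarith) hπ0
    have h3 : 2 * (2 * Real.sqrt 2) * (Real.pi * (ρ * d)) ≤ 160 * (R₀ + 9) * (1 + h) * ρ := by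
      have : 2 * (2 * Real.sqrt 2) * (Real.pi * (ρ * d)) = (4 * Real.sqrt 2 * Real.pi) * d * ρ := by ring
      rw [this]
      have h5 : (4 * Real.sqrt 2 * Real.pi) * d ≤ 18 * (4 * (R₀ + 9) * (1 + h)) := mul_le_mul h418 hdle hd0 (by norm_num)
      nlinarith
    nlinarith [mul_le_mul_of_nonneg_left h2 (by positivity : 0 ≤ 2 * (2 * Real.sqrt 2))]
  -- the shrunken slice and the annulus
  push Not at hsmall
  set ρ' : ℝ := ρ - d with hρ'
  have hρ'0 : 0 ≤ ρ' := by rw [hρ']; linarith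
  have hρ'ρ : ρ' ≤ ρ := by rw [hρ']; linarith
  set S : Set E3 := wallSlice ρ with hS
  set S' : Set E3 := wallSlice ρ' with hS'
  set ann : Set E3 := S \ S' with hann
  have hS'S : S' ⊆ S := wallSlice_mono hρ'ρ hρ'0
  have hSm : MeasurableSet S := measurableSet_wallSlice ρ
  have hS'm : MeasurableSet S' := measurableSet_wallSlice ρ'
  have hannm : MeasurableSet ann := hSm.diff hS'm
  have hannfin : volume ann ≠ ⊤ := ne_top_of_le_ne_top (hSfin ρ hρ) (measure_mono Set.sdiff_subset)
  -- split the charge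
  set f : Set E3 → ℤ × ℤ → ℝ := fun X ij => c ij.1 ij.2 * (volume (X ∩ laySlab L₁ s₁ ij.1 ∩ laySlab L₂ s₂ ij.2)).toReal with hf
  have hsplit : ∀ ij, f S ij = f S' ij + f ann ij := by
    intro ij
    simp only [hf]
    have hset : S ∩ laySlab L₁ s₁ ij.1 ∩ laySlab L₂ s₂ ij.2 =
        (S' ∩ laySlab L₁ s₁ ij.1 ∩ laySlab L₂ s₂ ij.2) ∪ (ann ∩ laySlab L₁ s₁ ij.1 ∩ laySlab L₂ s₂ ij.2) := by
      rw [← Set.union_inter_distrib_right, ← Set.union_inter_distrib_right, hann, Set.union_sdiff_cancel hS'S]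
    have hdisj : Disjoint (S' ∩ laySlab L₁ s₁ ij.1 ∩ laySlab L₂ s₂ ij.2) (ann ∩ laySlab L₁ s₁ ij.1 ∩ laySlab L₂ s₂ ij.2) :=
      (Set.disjoint_sdiff_right).mono (Set.inter_subset_left.trans Set.inter_subset_left)
        (Set.inter_subset_left.trans Set.inter_subset_left)
    rw [hset, measure_union hdisj ((hannm.inter (measurableSet_laySlab L₁ s₁ _)).inter (measurableSet_laySlab L₂ s₂ _)),
      ENNReal.toReal_add (ne_top_of_le_ne_top (hSfin ρ' hρ'0) (measure_mono (Set.inter_subset_left.trans Set.inter_subset_left)))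
        (ne_top_of_le_ne_top hannfin (measure_mono (Set.inter_subset_left.trans Set.inter_subset_left))), mul_add]
  have hsumS' := summable_charge L₁ L₂ s₁ s₂ c (2 * Real.sqrt 2) hc0 hcB S' hS'm (hSfin ρ' hρ'0)
  have hsumA := summable_charge L₁ L₂ s₁ s₂ c (2 * Real.sqrt 2) hc0 hcB ann hannm hannfin
  have hQ : ∑' ij, f S ij = ∑' ij, f S' ij + ∑' ij, f ann ij := by
    rw [← hsumS'.tsum_add hsumA]; exact tsum_congr hsplit
  -- the shrunken slice: flux, split into the weighted zigzag and in-layer parts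
  have hflux := charge_le_flux L₁ L₂ s₁ s₂ κ₁ κ₂ c (2 * Real.sqrt 2) hκ₁0 hκ₁B hκ₂0 hκ₂B hc0 hdomκ S' hS'm (hSfin ρ' hρ'0)
  have hsplit₁ := tsum_flux_add L₁ s₁ (fun i => a₁ * plateFlux τ₀ L₁ σ₁ e₃ i) (fun i => b₁ * rowFlux τ₀ L₁ σ₁ e₃ i) (Real.sqrt 2)
    (fun i => (hw ha₁ ha₁1 (plateFlux_nonneg τ₀ L₁ σ₁ he₃ i) (plateFlux_le_sqrt_two τ₀ L₁ σ₁ he₃ i)).1)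
    (fun i => (hw ha₁ ha₁1 (plateFlux_nonneg τ₀ L₁ σ₁ he₃ i) (plateFlux_le_sqrt_two τ₀ L₁ σ₁ he₃ i)).2)
    (fun i => (hw hb₁ hb₁1 (hrow₁ i).1 (hrow₁ i).2).1) (fun i => (hw hb₁ hb₁1 (hrow₁ i).1 (hrow₁ i).2).2) S' hS'm (hSfin ρ' hρ'0)
  have hsplit₂ := tsum_flux_add L₂ s₂ (fun j => a₂ * plateFlux τ₀ L₂ σ₂ (-e₃) j) (fun j => b₂ * rowFlux τ₀ L₂ σ₂ (-e₃) j)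
    (Real.sqrt 2)
    (fun j => (hw ha₂ ha₂1 (plateFlux_nonneg τ₀ L₂ σ₂ hne₃ j) (plateFlux_le_sqrt_two τ₀ L₂ σ₂ hne₃ j)).1)
    (fun j => (hw ha₂ ha₂1 (plateFlux_nonneg τ₀ L₂ σ₂ hne₃ j) (plateFlux_le_sqrt_two τ₀ L₂ σ₂ hne₃ j)).2)
    (fun j => (hw hb₂ hb₂1 (hrow₂ j).1 (hrow₂ j).2).1) (fun j => (hw hb₂ hb₂1 (hrow₂ j).1 (hrow₂ j).2).2) S' hS'm (hSfin ρ' hρ'0)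
  simp only [hκ₁, hκ₂] at hflux
  rw [hsplit₁, hsplit₂] at hflux
  -- pull the constants out of the four sums
  have hpull : ∀ (Lx : E3 ≃ₗᵢ[ℝ] E3) (sx : E3) (a : ℝ) (f : ℤ → ℝ),
      ∑' i : ℤ, a * f i * (volume (S' ∩ laySlab Lx sx i)).toReal = a * ∑' i : ℤ, f i * (volume (S' ∩ laySlab Lx sx i)).toReal := by
    intro Lx sx a f; rw [← tsum_mul_left]; exact tsum_congr fun i => by ring
  rw [hpull, hpull, hpull, hpull] at hflux
  -- the row flux as a weight on the layer flux
  have hωrow : ∀ (Lx : E3 ≃ₗᵢ[ℝ] E3) (σx : ℤ → ℤ) (z : E3) (i : ℤ),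
      rowFlux τ₀ Lx σx z i = (if IsCLayer σx i then (1 : ℝ) else 0) * layerFlux τ₀ Lx z := by
    intro Lx σx z i; unfold rowFlux; split_ifs <;> simp
  -- plate 1: zigzag lines and rows
  have hS'sub₁ : S' ⊆ {p : E3 | (0 : ℝ) ≤ ⟪p, e₃⟫_ℝ ∧ ⟪p, e₃⟫_ℝ ≤ 0 + 1 ∧ Real.sqrt (p 0 ^ 2 + p 1 ^ 2) ≤ ρ'} := by
    rintro p ⟨h1, h2, h3⟩
    refine ⟨by rw [hi₃]; exact h1, by rw [hi₃]; linarith, ?_⟩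
    rw [← Real.sqrt_sq hρ'0]; exact Real.sqrt_le_sqrt h3
  have hP₁ := plate_lines_ge_flux_sel hσ₁ L₁ s₁ e₃ he₃ hsel₁ τ₀ ρ' 0 (-R₀ - 4) (by linarith) S' hS'm (hSfin ρ' hρ'0) hS'sub₁ T₁
    (fun t ⟨k, hk1, hk2, hk3⟩ => hT₁ t ⟨k, by rw [hi₃] at hk1; linarith, by rw [hi₃] at hk2; linarith,
      hk3.trans (by rw [hρ', hd]; linarith)⟩)
  have hR₁ := layer_lines_ge_flux_strip σ₁ L₁ s₁ e₃ he₃ τ₀ hτ₀ ρ' 0 (-R₀ - 4) (by linarith) S' hS'm hS'sub₁ (hSfin ρ' hρ'0)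
    (fun k => if IsCLayer σ₁ k then (1 : ℝ) else 0) (fun k => by split_ifs <;> norm_num) (fun k => by split_ifs <;> norm_num) T₃
    (fun kj hk ⟨i, hk1, hk2, hk3⟩ => hT₃ kj (by by_contra hc; rw [if_neg hc] at hk; exact lt_irrefl _ hk)
      ⟨i, by rw [hi₃] at hk1; linarith, by rw [hi₃] at hk2; linarith, hk3.trans (by rw [hρ', hd]; linarith)⟩)
  simp only [← hωrow] at hR₁
  -- plate 2
  have hS'sub₂ : S' ⊆ {p : E3 | (-1 : ℝ) ≤ ⟪p, -e₃⟫_ℝ ∧ ⟪p, -e₃⟫_ℝ ≤ -1 + 1 ∧ Real.sqrt (p 0 ^ 2 + p 1 ^ 2) ≤ ρ'} := by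
    rintro p ⟨h1, h2, h3⟩
    refine ⟨by rw [inner_neg_right, hi₃]; linarith, by rw [inner_neg_right, hi₃]; linarith, ?_⟩
    rw [← Real.sqrt_sq hρ'0]; exact Real.sqrt_le_sqrt h3
  have hP₂ := plate_lines_ge_flux_sel hσ₂ L₂ s₂ (-e₃) hne₃ hsel₂ τ₀ ρ' (-1) (-h - R₀ - 4) (by linarith) S' hS'm (hSfin ρ' hρ'0)
    hS'sub₂ T₂ (fun t ⟨k, hk1, hk2, hk3⟩ => hT₂ t ⟨k, by rw [inner_neg_right, hi₃] at hk2; linarith,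
      by rw [inner_neg_right, hi₃] at hk1; linarith, hk3.trans (by rw [hρ', hd]; linarith)⟩)
  have hR₂ := layer_lines_ge_flux_strip σ₂ L₂ s₂ (-e₃) hne₃ τ₀ hτ₀ ρ' (-1) (-h - R₀ - 4) (by linarith) S' hS'm hS'sub₂
    (hSfin ρ' hρ'0) (fun k => if IsCLayer σ₂ k then (1 : ℝ) else 0) (fun k => by split_ifs <;> norm_num)
    (fun k => by split_ifs <;> norm_num) T₄
    (fun kj hk ⟨i, hk1, hk2, hk3⟩ => hT₄ kj (by by_contra hc; rw [if_neg hc] at hk; exact lt_irrefl _ hk)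
      ⟨i, by rw [inner_neg_right, hi₃] at hk2; linarith, by rw [inner_neg_right, hi₃] at hk1; linarith,
      hk3.trans (by rw [hρ', hd]; linarith)⟩)
  simp only [← hωrow] at hR₂
  -- weighted family counts
  have hP₁' := mul_le_mul_of_nonneg_left hP₁ ha₁
  have hP₂' := mul_le_mul_of_nonneg_left hP₂ ha₂
  have hR₁' := mul_le_mul_of_nonneg_left hR₁ hb₁
  have hR₂' := mul_le_mul_of_nonneg_left hR₂ hb₂
  -- the annulus
  have hA := two_charge_le_const L₁ L₂ s₁ s₂ c (2 * Real.sqrt 2) hc0 hcB ann hannm hannfin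
  have hvolann : (volume ann).toReal = Real.pi * ρ ^ 2 - Real.pi * ρ' ^ 2 := by
    have hu : volume S = volume S' + volume ann := by
      rw [← measure_union (Set.disjoint_sdiff_right) hannm, Set.union_sdiff_cancel hS'S]
    rw [hS, hS', volume_wallSlice ρ hρ, volume_wallSlice ρ' hρ'0] at hu
    have h1 : volume ann = ENNReal.ofReal (Real.pi * ρ ^ 2) - ENNReal.ofReal (Real.pi * ρ' ^ 2) :=
      (ENNReal.sub_eq_of_eq_add_rev ENNReal.ofReal_ne_top hu).symm
    rw [h1, ← ENNReal.ofReal_sub _ (by positivity), ENNReal.toReal_ofReal]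
    nlinarith [mul_le_mul_of_nonneg_left (pow_le_pow_left₀ hρ'0 hρ'ρ 2) hπ0]
  have hannle : (volume ann).toReal ≤ 2 * Real.pi * ρ * d := by
    rw [hvolann, hρ']; nlinarith [mul_nonneg hπ0 (sq_nonneg d)]
  -- assemble
  have hmain : 2 * ∑' ij, f S ij ≤
      a₁ * (T₁.card : ℝ) + a₂ * T₂.card + b₁ * T₃.card + b₂ * T₄.card + 2 * (2 * Real.sqrt 2) * (2 * Real.pi * ρ * d) := by
    rw [hQ, mul_add]
    have h1 : 2 * ∑' ij, f S' ij ≤ a₁ * (T₁.card : ℝ) + a₂ * T₂.card + b₁ * T₃.card + b₂ * T₄.card := by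
      simp only [hf] at hflux ⊢; linarith
    have h2 : 2 * ∑' ij, f ann ij ≤ 2 * (2 * Real.sqrt 2) * (2 * Real.pi * ρ * d) := by
      simp only [hf] at hA ⊢
      exact hA.trans (mul_le_mul_of_nonneg_left hannle (by positivity))
    linarith
  have hconst : 2 * (2 * Real.sqrt 2) * (2 * Real.pi * ρ * d) ≤ 160 * (R₀ + 9) * (1 + h) * ρ := by
    have : 2 * (2 * Real.sqrt 2) * (2 * Real.pi * ρ * d) = 2 * ((4 * Real.sqrt 2 * Real.pi) * d * ρ) := by ring
    rw [this]
    have h5 : (4 * Real.sqrt 2 * Real.pi) * d ≤ 18 * (4 * (R₀ + 9) * (1 + h)) := mul_le_mul h418 hdle hd0 (by norm_num)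
    have h6 : (4 * Real.sqrt 2 * Real.pi) * d * ρ ≤ 18 * (4 * (R₀ + 9) * (1 + h)) * ρ := mul_le_mul_of_nonneg_right h5 hρ
    have hY : 0 ≤ (R₀ + 9) * (1 + h) * ρ := mul_nonneg (mul_nonneg (by linarith) (by linarith)) hρ
    linarith only [h6, hY]
  simp only [hf] at hmain
  linarith

end Summit.Ventures.Crystal3D.Theorems

end
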